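import Literature.NumberTheory.ComplexMultiplication.CMTorusIsomorphismClassesExactOrderCount
import HarnessLib

/-!
# `Pic(S) ⊆ ICM(𝔯)` IS `ClassGroup S`: THEOREM 4.6 with Mathlib's Picard group, and its torus level

Layer A3 of the Hodge/CM programme (docs/m5/MAPPING.md §1), the "arbitrary order" series on the carrier
`FractionalIdeal (endOrder (M_μ))⁰ K`.  In `CMOrderWeakClassesCount` (Marseglia's THEOREM 4.6) the Picard group of
an over-order `S ⊇ 𝔯` appears INSIDE `ICM(𝔯)`, as the classes of the `𝔯`-ideals `L` with `(L:L) = S` and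
`L·(S:L) = S`; `CMOrderIdealClassMonoidOverorderCount` identified the whole stratum with Mathlib's `ClassGroup S` for
QUADRATIC orders (Bass: the stratum is `Pic(S)`).  This file does the identification in ANY degree, for every
over-order `S = endOrder (M_ν) ⊇ 𝔯 = endOrder (M_μ)` (every over-order is of this form,
`CMOrderIdealClassMonoidOverorderCount.exists_basis_coe_span_eq_and_endOrder_eq`):

* §1 transport `𝔯`-ideals ↔ `S`-ideals on the same lattice (`exists_overorderIdeal_coe_eq`,
  `exists_coe_eq_overorderIdeal`, `coe_mul_eq_coe_mul_of_coe_eq`, `coe_one_eq_coe_endOrder`);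
* §2 `exists_units_coe_eq_of_mul_div_self_div_eq` / `exists_pic_stratum_coe_eq_units` — the `𝔯`-ideals invertible in
  their multiplicator ring `S` are exactly the lattices of the units of `𝓘(S)` [Marseglia2019, §2 Lemma 2.5, §3];
* §3 **`nonempty_quot_pic_stratum_equiv_classGroup`** — `Pic(S) ⊆ ICM(𝔯)` `≃ ClassGroup S`; hence THEOREM 4.6 as
  printed, **`natCard_quot_stratum_eq_natCard_quot_weak_mul_natCard_classGroup`**: `#ICM_S(𝔯) = #W̄k(S) · #ClassGroup S`,
  and `natCard_quot_stratum_eq_natCard_classGroup_iff_forall_div_div_eq`: `= #ClassGroup S` iff `S` is Gorenstein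
  [Marseglia2019, Thm. 4.6 and §4 remark; BuchmannLenstra1994, Prop. 2.7];
* §4 TORUS LEVEL (`CMTorusIsomorphismClassesExactOrderCount`): the `K`-isomorphism classes of the CM tori
  `(ℂ^Φ/D(𝔪), ι)` of type `(K, Φ)` with `ι(𝔯) ⊆ End` and endomorphism order EXACTLY `S` number
  `#W̄k(S) · #ClassGroup S`, `= #ClassGroup S` iff `S` is Gorenstein [Shimura1998, §7.4 Props. 15–17];
* §5 **`natCard_quot_exists_bijective_comm_eq_natCard_classGroup_of_monogenic`** — for a MONOGENIC over-order
  `S = ℤ[π]` exactly `#ClassGroup ℤ[π]` classes of tori have endomorphism ring `ℤ[π]` (monogenic ⟹ Gorenstein,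
  `CMOrderGorenstein.div_div_eq_of_monogenic`) [Marseglia2019, Prop. 3.3; BuchmannLenstra1994, Example 2.8] — the
  case `ℤ[π] = 𝓞_K` being Shimura's PROPOSITION 17 (`CMTorusIsomorphismClassesMaximalEndomorphismRingCount`).

Conventions as in `CMOrderWeakClassesCount`: stratum `{M ≠ 0 // ↑(M/M) = S}`, isomorphism `M = x·N` (`x ≠ 0`),
weak equivalence `1 ∈ (M:N)(N:M)`, «`S` Gorenstein» `∀ I ≠ 0, MI = I → (M:(M:I)) = I` for `M = MM ≠ 0`, `↑M = S`.
Theorems only (no new definitions, no named facts).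

## References
* [Marseglia2019] S. Marseglia, *Computing the ideal class monoid of an order*, J. Lond. Math. Soc. 101 (2020),
  arXiv:1805.09671 — §2 Lemmas 2.2, 2.5 pp. 4–5; §3 Prop. 3.3, Def. 3.5 pp. 5–6; §4 Thm. 4.6 p. 9.
* [BuchmannLenstra1994] J. A. Buchmann, H. W. Lenstra Jr., *Approximating rings of integers in number fields*,
  JTNB 6 (1994) — §2 Prop. 2.7 p. 230, Example 2.8 p. 231.
* [Shimura1998] G. Shimura, *Abelian varieties with complex multiplication and modular functions*, PUP 1998 —
  §7.4 Props. 15–17, pp. 57–58.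
* [Cox2013] D. A. Cox, *Primes of the form x² + ny²*, 2nd ed., Wiley 2013 — §7.A, pp. 135–136.
-/

noncomputable section

open scoped Classical nonZeroDivisors NumberField Pointwise
open NumberField Module FractionalIdeal

namespace Literature.NumberTheory.ComplexMultiplication

open Literature.AlgebraicGeometry.Motives (CMType)
open Literature.AlgebraicGeometry.ComplexMultiplication (CMTorus.periodEquiv)
open Literature.Geometry.Kaehler
open Literature.Geometry.Kaehler.ComplexTorus (mapMatrix)

namespace CMTypeLattice

section OverorderPicard

variable {K : Type} [Field K] [NumberField K]
variable {ι : Type} [Fintype ι] [DecidableEq ι] (μ ν : Basis ι ℚ K)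
variable [IsFractionRing (endOrder (Algebra.leftMulMatrix μ)) K]

/-! ## §1 Transport between fractional `𝔯`-ideals and fractional `S`-ideals, `S = endOrder (M_ν) ⊇ 𝔯` -/

omit [NumberField K] [Fintype ι] [DecidableEq ι] [IsFractionRing (endOrder (Algebra.leftMulMatrix μ)) K] in
/-- `x·I = x • I` as subsets of `K` (bookkeeping). [cite: Marseglia2019, §3 Cor. 3.4 («`I = αJ`»), p. 6] -/
private theorem coe_spanSingleton_mul_eq_smul' {R : Type*} [CommRing R] {S : Submonoid R} [Algebra R K]
    [IsLocalization S K] (x : K) (I : FractionalIdeal S K) :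
    ((spanSingleton S x * I : FractionalIdeal S K) : Set K) = x • (I : Set K) := by
  ext y
  rw [SetLike.mem_coe, mem_singleton_mul, Set.mem_smul_set]
  exact ⟨fun ⟨y', hy', h⟩ => ⟨y', hy', h.symm⟩, fun ⟨y', hy', h⟩ => ⟨y', hy', h.symm⟩⟩

omit [IsFractionRing (endOrder (Algebra.leftMulMatrix μ)) K] in
/-- `↑(1 : 𝓘(S)) = S` for the order `S = endOrder (M_ν)` (bookkeeping). [cite: Marseglia2019, §2 («`1 ∈ (I:I)`»), p. 4] -/
theorem coe_one_eq_coe_endOrder :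
    ((1 : FractionalIdeal (endOrder (Algebra.leftMulMatrix ν))⁰ K) : Set K) = (endOrder (Algebra.leftMulMatrix ν) : Set K) := by
  ext x
  rw [SetLike.mem_coe, SetLike.mem_coe, mem_one_iff]
  exact ⟨fun ⟨x', h⟩ => h ▸ x'.2, fun hx => ⟨⟨x, hx⟩, rfl⟩⟩

omit [IsFractionRing (endOrder (Algebra.leftMulMatrix μ)) K] in
/-- **An `𝔯`-ideal which is an `S`-module IS a fractional `S`-ideal** (same lattice; `S = endOrder (M_ν) ⊇ 𝔯`): its
`ℤ`-basis spans a lattice whose order contains `S`. [cite: Marseglia2019, §2 («`I` is also an `S`-ideal … if and only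
if `IS = I`»), p. 4] -/
theorem exists_overorderIdeal_coe_eq [IsFractionRing (endOrder (Algebra.leftMulMatrix μ)) K]
    {N : FractionalIdeal (endOrder (Algebra.leftMulMatrix μ))⁰ K} (hN0 : N ≠ 0)
    (hSN : ∀ s ∈ endOrder (Algebra.leftMulMatrix ν), ∀ n ∈ N, s * n ∈ N) :
    ∃ N' : FractionalIdeal (endOrder (Algebra.leftMulMatrix ν))⁰ K, N' ≠ 0 ∧ (N' : Set K) = N := by
  obtain ⟨ν', -, hN⟩ := exists_basis_le_endOrder_and_coe_eq μ hN0
  have hle : endOrder (Algebra.leftMulMatrix ν) ≤ endOrder (Algebra.leftMulMatrix ν') := fun s hs => by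
    rw [← SetLike.mem_coe, ← coe_div_self_eq_coe_endOrder μ hN0 hN, SetLike.mem_coe, mem_div_iff_of_ne_zero hN0]
    exact hSN s hs
  obtain ⟨N', hN'0, hN'⟩ := exists_fractionalIdeal_coe_eq (Algebra.leftMulMatrix ν) ν' hle
  exact ⟨N', hN'0, hN'.trans hN.symm⟩

omit [IsFractionRing (endOrder (Algebra.leftMulMatrix μ)) K] in
/-- **Conversely a fractional `S`-ideal IS a fractional `𝔯`-ideal** for `𝔯 ≤ S` (an `S`-module is an `𝔯`-module,
finitely generated over `ℤ`). [cite: Marseglia2019, §2 («every over-order `S` of `R` is a fractional `R`-ideal»), p. 4] -/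
theorem exists_coe_eq_overorderIdeal (hle : endOrder (Algebra.leftMulMatrix μ) ≤ endOrder (Algebra.leftMulMatrix ν))
    {N' : FractionalIdeal (endOrder (Algebra.leftMulMatrix ν))⁰ K} (hN'0 : N' ≠ 0) :
    ∃ N : FractionalIdeal (endOrder (Algebra.leftMulMatrix μ))⁰ K, N ≠ 0 ∧ (N : Set K) = N' := by
  obtain ⟨ν', hνν', hN'⟩ := exists_basis_le_endOrder_and_coe_eq ν hN'0
  obtain ⟨N, hN0, hN⟩ := exists_fractionalIdeal_coe_eq (Algebra.leftMulMatrix μ) ν' (hle.trans hνν')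
  exact ⟨N, hN0, hN.trans hN'.symm⟩

omit [IsFractionRing (endOrder (Algebra.leftMulMatrix μ)) K] in
/-- **Products are computed on lattices**: `↑N₁ = ↑N₁′`, `↑N₂ = ↑N₂′` ⟹ `↑(N₁N₂) = ↑(N₁′N₂′)` (both are the
`ℤ`-module generated by the products). [cite: Marseglia2019, §2 («`IJ` … generated by the elements of the form `ij`»), p. 4] -/
theorem coe_mul_eq_coe_mul_of_coe_eq {N₁ N₂ : FractionalIdeal (endOrder (Algebra.leftMulMatrix μ))⁰ K}
    {N₁' N₂' : FractionalIdeal (endOrder (Algebra.leftMulMatrix ν))⁰ K} (h₁ : (N₁ : Set K) = N₁')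
    (h₂ : (N₂ : Set K) = N₂') :
    ((N₁ * N₂ : FractionalIdeal (endOrder (Algebra.leftMulMatrix μ))⁰ K) : Set K) =
      ((N₁' * N₂' : FractionalIdeal (endOrder (Algebra.leftMulMatrix ν))⁰ K) : Set K) := by
  have h : ((N₁ * N₂ : FractionalIdeal (endOrder (Algebra.leftMulMatrix μ))⁰ K) :
      Submodule (endOrder (Algebra.leftMulMatrix μ)) K).restrictScalars ℤ =
      ((N₁' * N₂' : FractionalIdeal (endOrder (Algebra.leftMulMatrix ν))⁰ K) :
        Submodule (endOrder (Algebra.leftMulMatrix ν)) K).restrictScalars ℤ := by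
    rw [coe_mul, Submodule.restrictScalars_mul, coe_mul, Submodule.restrictScalars_mul]
    congr 1
    · exact SetLike.ext' (by rw [Submodule.coe_restrictScalars, Submodule.coe_restrictScalars]; exact h₁)
    · exact SetLike.ext' (by rw [Submodule.coe_restrictScalars, Submodule.coe_restrictScalars]; exact h₂)
  ext x
  rw [SetLike.mem_coe, SetLike.mem_coe, ← mem_coe, ← Submodule.restrictScalars_mem ℤ, h,
    Submodule.restrictScalars_mem, mem_coe]

/-- **An ideal with multiplicator ring `S` is an `S`-module** (`(L:L) = S` elementwise).
[cite: Marseglia2019, §2 («the biggest over-order of `R` for which `I` is a fractional ideal»), p. 4] -/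
theorem forall_mul_mem_of_coe_div_self_eq {L : FractionalIdeal (endOrder (Algebra.leftMulMatrix μ))⁰ K} (hL0 : L ≠ 0)
    (hLS : ((L / L : FractionalIdeal (endOrder (Algebra.leftMulMatrix μ))⁰ K) : Set K) =
      (endOrder (Algebra.leftMulMatrix ν) : Set K)) :
    ∀ s ∈ endOrder (Algebra.leftMulMatrix ν), ∀ n ∈ L, s * n ∈ L := fun s hs => by
  have hs' : s ∈ ((L / L : FractionalIdeal (endOrder (Algebra.leftMulMatrix μ))⁰ K) : Set K) := by
    rw [hLS]
    exact hs
  exact (mem_div_iff_of_ne_zero hL0).1 hs'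

/-- **… and so is `(S:L) = ((L:L):L)`** (`S·(S:L) = (S:L)`). [cite: Marseglia2019, §2 Lemma 2.5 (proof), p. 5] -/
theorem forall_mul_mem_div_self_div_of_coe_div_self_eq {L : FractionalIdeal (endOrder (Algebra.leftMulMatrix μ))⁰ K}
    (hL0 : L ≠ 0) (hLS : ((L / L : FractionalIdeal (endOrder (Algebra.leftMulMatrix μ))⁰ K) : Set K) =
      (endOrder (Algebra.leftMulMatrix ν) : Set K)) :
    ∀ s ∈ endOrder (Algebra.leftMulMatrix ν), ∀ n ∈ L / L / L, s * n ∈ L / L / L := fun s hs n hn => by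
  have hs' : s ∈ ((L / L : FractionalIdeal (endOrder (Algebra.leftMulMatrix μ))⁰ K) : Set K) := by
    rw [hLS]
    exact hs
  rw [← EndOrder.div_self_mul_div_self_div hL0]
  exact mul_mem_mul hs' hn

/-! ## §2 `Pic(S) ⊆ ICM(𝔯)` IS the Picard group of `S`: units of `𝓘(S)` ↔ `𝔯`-ideals invertible in `S` -/

/-- **An `𝔯`-ideal `L` invertible in its multiplicator ring `S = (L:L)` (`L·(S:L) = S`) IS an invertible
fractional `S`-ideal** — a unit of Mathlib's `FractionalIdeal S⁰ K` with the same lattice. [cite: Marseglia2019, §3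
(«`[I]` is in `Pic(S)`»; Def. 3.5 `Pic`), p. 6] -/
theorem exists_units_coe_eq_of_mul_div_self_div_eq {L : FractionalIdeal (endOrder (Algebra.leftMulMatrix μ))⁰ K}
    (hL0 : L ≠ 0) (hLS : ((L / L : FractionalIdeal (endOrder (Algebra.leftMulMatrix μ))⁰ K) : Set K) =
      (endOrder (Algebra.leftMulMatrix ν) : Set K)) (hinv : L * (L / L / L) = L / L) :
    ∃ I : (FractionalIdeal (endOrder (Algebra.leftMulMatrix ν))⁰ K)ˣ,
      ((I : FractionalIdeal (endOrder (Algebra.leftMulMatrix ν))⁰ K) : Set K) = L := by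
  haveI := isFractionRing_endOrder (Algebra.leftMulMatrix ν)
  obtain ⟨L', -, hL'⟩ := exists_overorderIdeal_coe_eq μ ν hL0 (forall_mul_mem_of_coe_div_self_eq μ ν hL0 hLS)
  have hW0 : L / L / L ≠ 0 := fun h => EndOrder.div_self_ne_zero hL0 (by rw [← hinv, h, mul_zero])
  obtain ⟨W', -, hW'⟩ := exists_overorderIdeal_coe_eq μ ν hW0 (forall_mul_mem_div_self_div_of_coe_div_self_eq μ ν hL0 hLS)
  have h1 : L' * W' = 1 := by
    apply SetLike.coe_injective
    rw [← coe_mul_eq_coe_mul_of_coe_eq μ ν hL'.symm hW'.symm, hinv, hLS, coe_one_eq_coe_endOrder]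
  exact ⟨Units.mkOfMulEqOne L' W' h1, by rw [Units.val_mkOfMulEqOne]; exact hL'⟩

/-- **Conversely an invertible fractional `S`-ideal IS an `𝔯`-ideal invertible in its multiplicator ring `S`**
(`𝔯 ≤ S = endOrder (M_ν)`; the `𝔯`-ideal with the lattice of `I`: `(L:L) = S` by LEMMA 2.5 and `L·(S:L) = S`).
[cite: Marseglia2019, §2 Lemma 2.5 and §3 («`ICM(R) ⊇ ⊔ Pic(S)`»), pp. 5–6] -/
theorem exists_pic_stratum_coe_eq_units (hle : endOrder (Algebra.leftMulMatrix μ) ≤ endOrder (Algebra.leftMulMatrix ν))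
    (I : (FractionalIdeal (endOrder (Algebra.leftMulMatrix ν))⁰ K)ˣ) :
    ∃ L : FractionalIdeal (endOrder (Algebra.leftMulMatrix μ))⁰ K,
      ((L ≠ 0 ∧ ((L / L : FractionalIdeal (endOrder (Algebra.leftMulMatrix μ))⁰ K) : Set K) =
        (endOrder (Algebra.leftMulMatrix ν) : Set K)) ∧ L * (L / L / L) = L / L) ∧
      (L : Set K) = ((I : FractionalIdeal (endOrder (Algebra.leftMulMatrix ν))⁰ K) : Set K) := by
  haveI := isFractionRing_endOrder (Algebra.leftMulMatrix ν)
  haveI : Nonempty ι := μ.index_nonempty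
  -- the `𝔯`-ideals with the lattices of `S = 1`, `I`, `I⁻¹`
  obtain ⟨P, hP0, hP⟩ := exists_coe_eq_overorderIdeal μ ν hle
    (one_ne_zero' (FractionalIdeal (endOrder (Algebra.leftMulMatrix ν))⁰ K))
  obtain ⟨L, hL0, hL⟩ := exists_coe_eq_overorderIdeal μ ν hle (Units.ne_zero I)
  obtain ⟨L₂, -, hL₂⟩ := exists_coe_eq_overorderIdeal μ ν hle (Units.ne_zero I⁻¹)
  have hPP : P * P = P := by
    apply SetLike.coe_injective
    rw [coe_mul_eq_coe_mul_of_coe_eq μ ν hP hP, one_mul, hP]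
  have hPL : P * L = L := by
    apply SetLike.coe_injective
    rw [coe_mul_eq_coe_mul_of_coe_eq μ ν hP hL, one_mul, hL]
  have hLL₂ : L * L₂ = P := by
    apply SetLike.coe_injective
    rw [coe_mul_eq_coe_mul_of_coe_eq μ ν hL hL₂, Units.mul_inv, hP]
  obtain ⟨hS, hpic⟩ := EndOrder.mul_div_self_div_eq_div_self_of_mul_eq hPP hP0 hPL hLL₂
  refine ⟨L, ⟨⟨hL0, ?_⟩, hpic⟩, hL⟩
  rw [hS, hP, coe_one_eq_coe_endOrder]

/-! ## §3 `Pic(S)` inside `ICM(𝔯)` `≃ ClassGroup S`; THEOREM 4.6 as printed: `#ICM_S(𝔯) = #W̄k(S) · #Pic(S)` -/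

/-- **`Pic(S) ⊆ ICM(𝔯)` IS the Picard group of the over-order `S = endOrder (M_ν)`: the classes modulo `K^×` of the
`𝔯`-ideals with multiplicator ring `S` invertible in `S` are in bijection with Mathlib's `ClassGroup S`**
(`[L] ↦ [L]`, same lattice; any degree — the quadratic (Bass) case, where the whole stratum is `Pic(S)`, is
`CMOrderIdealClassMonoidOverorderCount.nonempty_quot_stratum_equiv_classGroup`). [cite: Marseglia2019, §3 Def. 3.5
and («`ICM(R) ⊇ ⊔ Pic(S)`»), p. 6] [cite: Cox2013, §7.A («`C(𝒪) = I(𝒪)/P(𝒪)`»), pp. 135–136] -/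
theorem nonempty_quot_pic_stratum_equiv_classGroup
    (hle : endOrder (Algebra.leftMulMatrix μ) ≤ endOrder (Algebra.leftMulMatrix ν)) :
    Nonempty ((Quot fun L N : {L : FractionalIdeal (endOrder (Algebra.leftMulMatrix μ))⁰ K //
        (L ≠ 0 ∧ ((L / L : FractionalIdeal (endOrder (Algebra.leftMulMatrix μ))⁰ K) : Set K) =
          (endOrder (Algebra.leftMulMatrix ν) : Set K)) ∧ L * (L / L / L) = L / L} =>
      ∃ x : K, x ≠ 0 ∧ (L : FractionalIdeal (endOrder (Algebra.leftMulMatrix μ))⁰ K) =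
        spanSingleton (endOrder (Algebra.leftMulMatrix μ))⁰ x * N) ≃
      ClassGroup (endOrder (Algebra.leftMulMatrix ν))) := by
  haveI := isFractionRing_endOrder (Algebra.leftMulMatrix ν)
  -- the unit of `S` with the lattice of `L`
  have hU := fun L : {L : FractionalIdeal (endOrder (Algebra.leftMulMatrix μ))⁰ K //
      (L ≠ 0 ∧ ((L / L : FractionalIdeal (endOrder (Algebra.leftMulMatrix μ))⁰ K) : Set K) =
        (endOrder (Algebra.leftMulMatrix ν) : Set K)) ∧ L * (L / L / L) = L / L} =>
    exists_units_coe_eq_of_mul_div_self_div_eq μ ν L.2.1.1 L.2.1.2 L.2.2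
  let u : {L : FractionalIdeal (endOrder (Algebra.leftMulMatrix μ))⁰ K //
      (L ≠ 0 ∧ ((L / L : FractionalIdeal (endOrder (Algebra.leftMulMatrix μ))⁰ K) : Set K) =
        (endOrder (Algebra.leftMulMatrix ν) : Set K)) ∧ L * (L / L / L) = L / L} →
      (FractionalIdeal (endOrder (Algebra.leftMulMatrix ν))⁰ K)ˣ := fun L => (hU L).choose
  have hu : ∀ L, ((u L : FractionalIdeal (endOrder (Algebra.leftMulMatrix ν))⁰ K) : Set K) =
      (L : FractionalIdeal (endOrder (Algebra.leftMulMatrix μ))⁰ K) := fun L => (hU L).choose_spec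
  let f : {L : FractionalIdeal (endOrder (Algebra.leftMulMatrix μ))⁰ K //
      (L ≠ 0 ∧ ((L / L : FractionalIdeal (endOrder (Algebra.leftMulMatrix μ))⁰ K) : Set K) =
        (endOrder (Algebra.leftMulMatrix ν) : Set K)) ∧ L * (L / L / L) = L / L} →
      ClassGroup (endOrder (Algebra.leftMulMatrix ν)) := fun L => ClassGroup.mk K (u L)
  have hf : ∀ L N : {L : FractionalIdeal (endOrder (Algebra.leftMulMatrix μ))⁰ K //
      (L ≠ 0 ∧ ((L / L : FractionalIdeal (endOrder (Algebra.leftMulMatrix μ))⁰ K) : Set K) =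
        (endOrder (Algebra.leftMulMatrix ν) : Set K)) ∧ L * (L / L / L) = L / L},
      (∃ x : K, x ≠ 0 ∧ (L : FractionalIdeal (endOrder (Algebra.leftMulMatrix μ))⁰ K) =
      spanSingleton (endOrder (Algebra.leftMulMatrix μ))⁰ x * N) ↔ f L = f N := by
    intro L N
    rw [← mul_inv_eq_one, ← map_inv, ← map_mul, ClassGroup.mk_eq_one_iff, isPrincipal_iff, Units.val_mul]
    constructor
    · rintro ⟨x, -, hx⟩
      refine ⟨x, ?_⟩
      have hUL : (u L : FractionalIdeal (endOrder (Algebra.leftMulMatrix ν))⁰ K) =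
          spanSingleton (endOrder (Algebra.leftMulMatrix ν))⁰ x * u N := by
        apply SetLike.coe_injective
        rw [hu, coe_spanSingleton_mul_eq_smul', hu, hx, coe_spanSingleton_mul_eq_smul']
      rw [hUL, mul_assoc, Units.mul_inv, mul_one]
    · rintro ⟨x, hx⟩
      have hUL : (u L : FractionalIdeal (endOrder (Algebra.leftMulMatrix ν))⁰ K) =
          spanSingleton (endOrder (Algebra.leftMulMatrix ν))⁰ x * u N := by
        rw [← mul_one (u L : FractionalIdeal (endOrder (Algebra.leftMulMatrix ν))⁰ K), ← Units.inv_mul (u N),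
          ← mul_assoc, hx]
      have hL : (L : FractionalIdeal (endOrder (Algebra.leftMulMatrix μ))⁰ K) =
          spanSingleton (endOrder (Algebra.leftMulMatrix μ))⁰ x * N := by
        apply SetLike.coe_injective
        rw [← hu, hUL, coe_spanSingleton_mul_eq_smul', coe_spanSingleton_mul_eq_smul', hu]
      refine ⟨x, fun h0 => L.2.1.1 ?_, hL⟩
      rw [hL, h0, spanSingleton_zero, zero_mul]
  refine ⟨Equiv.ofBijective (Quot.lift f fun L N h => (hf L N).1 h) ⟨fun q₁ q₂ h => ?_, fun c => ?_⟩⟩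
  · induction q₁ using Quot.ind with
    | mk L =>
      induction q₂ using Quot.ind with
      | mk N => exact Quot.sound ((hf L N).2 h)
  · refine ClassGroup.induction K (fun I => ?_) c
    obtain ⟨L, hL, hLI⟩ := exists_pic_stratum_coe_eq_units μ ν hle I
    refine ⟨Quot.mk _ ⟨L, hL⟩, ?_⟩
    show f _ = _
    simp only [f]
    congr 1
    exact Units.ext (SetLike.coe_injective ((hu ⟨L, hL⟩).trans hLI))

/-- **`#`(`Pic(S)` inside `ICM(𝔯)`) `= #ClassGroup S`.** [cite: Marseglia2019, §3 Def. 3.5, p. 6] -/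
theorem natCard_quot_pic_stratum_eq_natCard_classGroup
    (hle : endOrder (Algebra.leftMulMatrix μ) ≤ endOrder (Algebra.leftMulMatrix ν)) :
    Nat.card (Quot fun L N : {L : FractionalIdeal (endOrder (Algebra.leftMulMatrix μ))⁰ K //
        (L ≠ 0 ∧ ((L / L : FractionalIdeal (endOrder (Algebra.leftMulMatrix μ))⁰ K) : Set K) =
          (endOrder (Algebra.leftMulMatrix ν) : Set K)) ∧ L * (L / L / L) = L / L} =>
      ∃ x : K, x ≠ 0 ∧ (L : FractionalIdeal (endOrder (Algebra.leftMulMatrix μ))⁰ K) =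
        spanSingleton (endOrder (Algebra.leftMulMatrix μ))⁰ x * N) =
      Nat.card (ClassGroup (endOrder (Algebra.leftMulMatrix ν))) :=
  Nat.card_congr (nonempty_quot_pic_stratum_equiv_classGroup μ ν hle).some

/-- **THEOREM 4.6 as printed: `W̄k(S) = ICM_S / Pic(S)`, counted — `#ICM_S(𝔯) = #W̄k(S) · #Pic(S)` with `Pic(S)`
Mathlib's `ClassGroup S`**, for every over-order `S = endOrder (M_ν) ⊇ 𝔯` (every over-order is of this form,
`CMOrderIdealClassMonoidOverorderCount.exists_basis_coe_span_eq_and_endOrder_eq`), any degree.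
[cite: Marseglia2019, §4 Thm. 4.6, p. 9] -/
theorem natCard_quot_stratum_eq_natCard_quot_weak_mul_natCard_classGroup
    (hle : endOrder (Algebra.leftMulMatrix μ) ≤ endOrder (Algebra.leftMulMatrix ν)) :
    Nat.card (Quot fun M N : {M : FractionalIdeal (endOrder (Algebra.leftMulMatrix μ))⁰ K //
        M ≠ 0 ∧ ((M / M : FractionalIdeal (endOrder (Algebra.leftMulMatrix μ))⁰ K) : Set K) =
          (endOrder (Algebra.leftMulMatrix ν) : Set K)} =>
      ∃ x : K, x ≠ 0 ∧ (M : FractionalIdeal (endOrder (Algebra.leftMulMatrix μ))⁰ K) =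
        spanSingleton (endOrder (Algebra.leftMulMatrix μ))⁰ x * N) =
    Nat.card (Quot fun M N : {M : FractionalIdeal (endOrder (Algebra.leftMulMatrix μ))⁰ K //
        M ≠ 0 ∧ ((M / M : FractionalIdeal (endOrder (Algebra.leftMulMatrix μ))⁰ K) : Set K) =
          (endOrder (Algebra.leftMulMatrix ν) : Set K)} =>
      (1 : K) ∈ (M : FractionalIdeal (endOrder (Algebra.leftMulMatrix μ))⁰ K) / N * (N / M)) *
    Nat.card (ClassGroup (endOrder (Algebra.leftMulMatrix ν))) := by
  haveI : Nonempty ι := μ.index_nonempty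
  rw [← natCard_quot_pic_stratum_eq_natCard_classGroup μ ν hle]
  exact EndOrder.natCard_quot_stratum_eq_natCard_quot_weak_mul_natCard_quot_pic (endOrder (Algebra.leftMulMatrix ν))

/-- **`S` is an over-order of `𝔯`, i.e. a nonzero idempotent `𝔯`-ideal `M = MM` with `↑M = S`** (`S = endOrder (M_ν) ⊇ 𝔯`).
[cite: Marseglia2019, §2 Lemma 2.2, p. 4] -/
theorem exists_idempotent_coe_eq_endOrder (hle : endOrder (Algebra.leftMulMatrix μ) ≤ endOrder (Algebra.leftMulMatrix ν)) :
    ∃ M : FractionalIdeal (endOrder (Algebra.leftMulMatrix μ))⁰ K,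
      M ≠ 0 ∧ M * M = M ∧ (M : Set K) = (endOrder (Algebra.leftMulMatrix ν) : Set K) := by
  haveI : Nonempty ι := μ.index_nonempty
  exact EndOrder.exists_fractionalIdeal_coe_eq_subring hle
    (EndOrder.moduleFinite_of_le_range (endOrder_le_range (Algebra.leftMulMatrix ν)))

/-- **`#ICM_S(𝔯) = #Pic(S) = #ClassGroup S` IF AND ONLY IF `S` is Gorenstein** (`(S:(S:I)) = I` for the `S`-ideals,
`S = ↑M`, `M = MM ≠ 0`). [cite: Marseglia2019, §4 Thm. 4.6 and the remark after Def. 4.2, pp. 8–9]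
[cite: BuchmannLenstra1994, §2 Prop. 2.7, p. 230] -/
theorem natCard_quot_stratum_eq_natCard_classGroup_iff_forall_div_div_eq
    (hle : endOrder (Algebra.leftMulMatrix μ) ≤ endOrder (Algebra.leftMulMatrix ν))
    {M : FractionalIdeal (endOrder (Algebra.leftMulMatrix μ))⁰ K} (hMM : M * M = M) (hM0 : M ≠ 0)
    (hMS : (M : Set K) = (endOrder (Algebra.leftMulMatrix ν) : Set K)) :
    Nat.card (Quot fun M N : {M : FractionalIdeal (endOrder (Algebra.leftMulMatrix μ))⁰ K //
        M ≠ 0 ∧ ((M / M : FractionalIdeal (endOrder (Algebra.leftMulMatrix μ))⁰ K) : Set K) =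
          (endOrder (Algebra.leftMulMatrix ν) : Set K)} =>
      ∃ x : K, x ≠ 0 ∧ (M : FractionalIdeal (endOrder (Algebra.leftMulMatrix μ))⁰ K) =
        spanSingleton (endOrder (Algebra.leftMulMatrix μ))⁰ x * N) =
      Nat.card (ClassGroup (endOrder (Algebra.leftMulMatrix ν))) ↔
    ∀ I : FractionalIdeal (endOrder (Algebra.leftMulMatrix μ))⁰ K, I ≠ 0 → M * I = I → M / (M / I) = I := by
  haveI : Nonempty ι := μ.index_nonempty
  rw [← natCard_quot_pic_stratum_eq_natCard_classGroup μ ν hle]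
  exact natCard_quot_stratum_eq_natCard_quot_pic_iff_forall_div_div_eq μ hMM hM0 hMS

/-! ## §4 TORUS LEVEL: the CM tori with endomorphism order EXACTLY `S` number `#W̄k(S) · #ClassGroup S` -/

/-- **THEOREM 4.6 at torus level with Mathlib's `ClassGroup S`**: for every CM type `Φ` and every over-order
`S = endOrder (M_ν) ⊇ 𝔯 = endOrder (M_μ)`, the `K`-isomorphism classes of the CM tori `(ℂ^Φ/D(𝔪), ι)`, `𝔪 = ⊕ ℤμ′ⱼ`
with `ι(𝔯) ⊆ End` and endomorphism order EXACTLY `S`, number `#W̄k(S) · #ClassGroup S`.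
[cite: Marseglia2019, §4 Thm. 4.6, p. 9] [cite: Shimura1998, §7.4 Props. 15–17, p. 58] -/
theorem natCard_quot_exists_bijective_comm_eq_natCard_quot_weak_mul_natCard_classGroup (Φ : CMType K)
    (hle : endOrder (Algebra.leftMulMatrix μ) ≤ endOrder (Algebra.leftMulMatrix ν)) :
    Nat.card (Quot fun μ' μ'' : {μ' : Basis ι ℚ K //
        endOrder (Algebra.leftMulMatrix μ) ≤ endOrder (Algebra.leftMulMatrix μ') ∧
          endOrder (Algebra.leftMulMatrix μ') = endOrder (Algebra.leftMulMatrix ν)} =>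
      ∃ A : Matrix ι ι ℤ,
        Function.Bijective
            (mapMatrix (CMTorus.periodEquiv Φ (μ' : Basis ι ℚ K)) (CMTorus.periodEquiv Φ (μ'' : Basis ι ℚ K)) A) ∧
          ∀ α : K, A.map (Int.cast : ℤ → ℚ) * Algebra.leftMulMatrix (μ' : Basis ι ℚ K) α =
            Algebra.leftMulMatrix (μ'' : Basis ι ℚ K) α * A.map (Int.cast : ℤ → ℚ)) =
    Nat.card (Quot fun M N : {M : FractionalIdeal (endOrder (Algebra.leftMulMatrix μ))⁰ K //
        M ≠ 0 ∧ ((M / M : FractionalIdeal (endOrder (Algebra.leftMulMatrix μ))⁰ K) : Set K) =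
          (endOrder (Algebra.leftMulMatrix ν) : Set K)} =>
      (1 : K) ∈ (M : FractionalIdeal (endOrder (Algebra.leftMulMatrix μ))⁰ K) / N * (N / M)) *
    Nat.card (ClassGroup (endOrder (Algebra.leftMulMatrix ν))) := by
  haveI : Nonempty ι := μ.index_nonempty
  rw [natCard_quot_exists_bijective_comm_eq_natCard_quot_stratum μ Φ (endOrder (Algebra.leftMulMatrix ν)),
    natCard_quot_stratum_eq_natCard_quot_weak_mul_natCard_classGroup μ ν hle]

/-- **… and `= #ClassGroup S` IF AND ONLY IF `S` is Gorenstein.** [cite: Marseglia2019, §4 Thm. 4.6 with the remark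
after Def. 4.2, pp. 8–9] [cite: Shimura1998, §7.4 Prop. 17, p. 58] -/
theorem natCard_quot_exists_bijective_comm_eq_natCard_classGroup_iff_forall_div_div_eq (Φ : CMType K)
    (hle : endOrder (Algebra.leftMulMatrix μ) ≤ endOrder (Algebra.leftMulMatrix ν))
    {M : FractionalIdeal (endOrder (Algebra.leftMulMatrix μ))⁰ K} (hMM : M * M = M) (hM0 : M ≠ 0)
    (hMS : (M : Set K) = (endOrder (Algebra.leftMulMatrix ν) : Set K)) :
    Nat.card (Quot fun μ' μ'' : {μ' : Basis ι ℚ K //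
        endOrder (Algebra.leftMulMatrix μ) ≤ endOrder (Algebra.leftMulMatrix μ') ∧
          endOrder (Algebra.leftMulMatrix μ') = endOrder (Algebra.leftMulMatrix ν)} =>
      ∃ A : Matrix ι ι ℤ,
        Function.Bijective
            (mapMatrix (CMTorus.periodEquiv Φ (μ' : Basis ι ℚ K)) (CMTorus.periodEquiv Φ (μ'' : Basis ι ℚ K)) A) ∧
          ∀ α : K, A.map (Int.cast : ℤ → ℚ) * Algebra.leftMulMatrix (μ' : Basis ι ℚ K) α =
            Algebra.leftMulMatrix (μ'' : Basis ι ℚ K) α * A.map (Int.cast : ℤ → ℚ)) =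
      Nat.card (ClassGroup (endOrder (Algebra.leftMulMatrix ν))) ↔
    ∀ I : FractionalIdeal (endOrder (Algebra.leftMulMatrix μ))⁰ K, I ≠ 0 → M * I = I → M / (M / I) = I := by
  haveI : Nonempty ι := μ.index_nonempty
  rw [natCard_quot_exists_bijective_comm_eq_natCard_quot_stratum μ Φ (endOrder (Algebra.leftMulMatrix ν))]
  exact natCard_quot_stratum_eq_natCard_classGroup_iff_forall_div_div_eq μ ν hle hMM hM0 hMS

/-! ## §5 Monogenic over-orders `S = ℤ[π]`: exactly `#ClassGroup ℤ[π]` tori with endomorphism ring `ℤ[π]` -/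

/-- **For a MONOGENIC over-order `S = ℤ[π] = endOrder (M_ν) ⊇ 𝔯` (Gorenstein: `CMOrderGorenstein.div_div_eq_of_monogenic`)
the CM tori of type `(K, Φ)` with multiplication by `𝔯` and endomorphism order EXACTLY `ℤ[π]` fall into
`#ClassGroup ℤ[π]` `K`-isomorphism classes** (e.g. `𝔯 = ℤ[π]` itself; Shimura's Prop. 17 is `ℤ[π] = 𝓞_K`).
[cite: Marseglia2019, §3 Prop. 3.3 («monogenic orders are Gorenstein») and §4 Thm. 4.6, pp. 5, 9]
[cite: BuchmannLenstra1994, §2 Example 2.8, p. 231, with Prop. 2.7, p. 230] [cite: Shimura1998, §7.4 Prop. 17, p. 58] -/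
theorem natCard_quot_exists_bijective_comm_eq_natCard_classGroup_of_monogenic (Φ : CMType K)
    (hle : endOrder (Algebra.leftMulMatrix μ) ≤ endOrder (Algebra.leftMulMatrix ν)) {π : K}
    (hπ : Algebra.adjoin ℚ {π} = ⊤) (hint : IsIntegral ℤ π)
    (hν : Submodule.span ℤ (Set.range ν) / Submodule.span ℤ (Set.range ν) = Subalgebra.toSubmodule (Algebra.adjoin ℤ {π})) :
    Nat.card (Quot fun μ' μ'' : {μ' : Basis ι ℚ K //
        endOrder (Algebra.leftMulMatrix μ) ≤ endOrder (Algebra.leftMulMatrix μ') ∧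
          endOrder (Algebra.leftMulMatrix μ') = endOrder (Algebra.leftMulMatrix ν)} =>
      ∃ A : Matrix ι ι ℤ,
        Function.Bijective
            (mapMatrix (CMTorus.periodEquiv Φ (μ' : Basis ι ℚ K)) (CMTorus.periodEquiv Φ (μ'' : Basis ι ℚ K)) A) ∧
          ∀ α : K, A.map (Int.cast : ℤ → ℚ) * Algebra.leftMulMatrix (μ' : Basis ι ℚ K) α =
            Algebra.leftMulMatrix (μ'' : Basis ι ℚ K) α * A.map (Int.cast : ℤ → ℚ)) =
      Nat.card (ClassGroup (endOrder (Algebra.leftMulMatrix ν))) := by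
  haveI : Nonempty ι := μ.index_nonempty
  obtain ⟨M, hM0, hMM, hMS⟩ := exists_idempotent_coe_eq_endOrder μ ν hle
  have hMπ : (M : Submodule (endOrder (Algebra.leftMulMatrix μ)) K).restrictScalars ℤ =
      Subalgebra.toSubmodule (Algebra.adjoin ℤ {π}) := by
    rw [← hν]
    ext x
    rw [Submodule.restrictScalars_mem, mem_coe, ← SetLike.mem_coe, hMS, SetLike.mem_coe,
      mem_endOrder_leftMulMatrix_iff_forall, Submodule.mem_div_iff_forall_mul_mem]
  exact (natCard_quot_exists_bijective_comm_eq_natCard_classGroup_iff_forall_div_div_eq μ ν Φ hle hMM hM0 hMS).2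
    fun I hI hMI => div_div_eq_of_monogenic μ hMM hM0 hπ hint hMπ hI hMI

end OverorderPicard

end CMTypeLattice

end Literature.NumberTheory.ComplexMultiplication
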